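import Summits.AnomalousDissipation.AnomalousDissipation.Theorems.SolenoidalFractalHomogenisationLagrangianStepOneLevelGlue
import Summits.AnomalousDissipation.AnomalousDissipation.Theorems.SolenoidalFractalHomogenisationLagrangianRenormalisationStepCascadeTelescoping
import Mathlib.Analysis.InnerProductSpace.Basic
import HarnessLib

/-!
# K1L `LagrangianRenormalisationStep` (stmt-AnomalousDissipation-24912) — crux idea `signed-corrector-ledger` (typed sketch, finding F-p4g7-1)

Planner `ad-ideate-p4` g7 (lens «control»), 2026-08-28.  Companion of `Ideas/signed-corrector-ledger.md`.

## §0 The structural fact (F-p4g7-1)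

The registered line `Lines/onelevel.lean` (v17) proves the crux as
`stub_oneLevelL ⟶ Chain E ⟶ (cascade_of_chain) Cascade E ⟶ (baseT, tailL, existsL) crux`.
`stub_oneLevelL` and `LagrangianStep.Chain` state TWO-SIDED a.e. drop ratios
`(1 - C ρ^σ)·drop v ≤ drop u ≤ (1 + C ρ^σ)·drop v`, but the ONLY consumer, the telescoping
`LagrangianRenormalisationStep.cascade_of_chain_abstract`, discards the upper inequality
(`simpa [hx_def] using ht.2.1` in the zero case, `obtain ⟨⟨_, hlow, _⟩, …⟩ := ht` in the successor case), and
`LagrangianStep.Cascade` is one-sided.  Hence the UPPER half of the load-bearing XL− stub is dead weight.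
This file certifies the lower-only composition path, sorry-free:

* `ChainLower E` — `Chain E` with the upper conjunct deleted; `chainLower_of_chain : Chain E → ChainLower E`;
* `cascade_of_chainLower_abstract`, `cascade_of_chainLower : … → ChainLower E → Cascade E` — the landed telescoping
  proof verbatim with the unused conjunct removed from the HYPOTHESIS (so the theorem is STRONGER than the landed one);
* `chainLower_of_pieces` — `chain_of_pieces` verbatim for a ONE-SIDED one-level step: the proposed v18 re-cut of
  `stub_oneLevelL` keeps every binder and the existence conjunct and concludes only
  `(1 - C₁ (N_m/N_{m+1})^{σ₁}) * drop w₀ v t ≤ drop w₀ u t`;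
* `chainLower_of_oneLevelLower` — the same with the base estimate discharged by the landed `LagrangianStep.stub_baseT`.

In the skeleton, v18 = v17 with (i) the last line of `stub_oneLevelL`'s conclusion deleted, (ii) `stub_cascadeT : … →
ChainLower E → Cascade E := … cascade_of_chainLower E hP hsq hCh`, (iii) `chain_of_pieces` ↦ `chainLower_of_pieces` in
`LagrangianRenormalisationStep_of` (two tokens).  The re-cut stub is IMPLIED by the registered one (drop a conjunct), so no
closed stub, probe or composition is disturbed; it is a weakening, not a split (the line card's dead line "one-sided split of
the comparison → shred" concerns cutting the comparison into two stubs, not deleting an unconsumed half).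

## §1 Why the surviving half is the natural one (the lever of the card)

`drop u ≥ (1-ε) drop v` is an UPPER bound on the fine problem's remaining energy `‖u(t)‖²` — the decay direction, the one
energy methods produce.  In the exact fast-band representation `q = Λ⁻¹(f - ∂ₜq)` (Lax–Milgram on the coercive fast band;
`f = -Q(b_{m+1}·∇p)` the slow-to-fast forcing, `A` the symmetric dissipation, `M := Λ⁻* A Λ⁻¹ ≥ 0`) the fast dissipation is
`⟪A q, q⟫ = ⟪M f, f⟫ - 2⟪M f, ∂ₜq⟫ + ⟪M ∂ₜq, ∂ₜq⟫`, where `⟪M f, f⟫` is the frozen-cell eddy form (Avellaneda–Majda's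
`⟨A∇χ·∇χ⟩` acting on `∇p`) and the non-quasi-static corrector dynamics sits ENTIRELY in the positive form `⟪M ∂ₜq, ∂ₜq⟫ ≥ 0`,
which the lower bound may simply drop (`signed_corrector_ledger` below, proved); the cross term integrates by parts onto the
slow clock.  The deleted upper half is exactly the statement that would need `∫⟪M ∂ₜq, ∂ₜq⟫ ≤ ε ∫⟪M f, f⟫`, i.e. sharp control
of transients.

No `sorry`; no new obligations; nothing here is registered — it is evidence for the tenure planner's v18 decision.
-/

set_option linter.dupNamespace false
set_option linter.unusedVariables false

namespace Summit.AnomalousDissipation.AnomalousDissipation.Cruxes.LagrangianRenormalisationStep.OneSidedChain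

open Literature.Analysis Literature.Analysis.FluidPDE Literature.Analysis.FunctionSpaces
open MeasureTheory Set Filter
open scoped ENNReal NNReal InnerProductSpace RealInnerProductSpace
open Summit.AnomalousDissipation.AnomalousDissipation.Theorems.SolenoidalFractalHomogenisation.LagrangianStep
open Summit.AnomalousDissipation.AnomalousDissipation.Theorems.SolenoidalFractalHomogenisation.LagrangianRenormalisationStep
  (two_pow_le_template ratio_le_half_pow)

noncomputable section

/-! ## §1 The signed corrector ledger (the lever, proved) -/

/-- **Signed corrector ledger (pointwise form).**  In a real inner product space, for a positive symmetric `A` and any linear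
`Λinv` (the fast-band solution operator), with `q = Λinv (f - r)` (`r = ∂ₜq`), the dissipation `⟪A q, q⟫` is bounded BELOW by the
quasi-static eddy form minus the cross term: the dynamic defect `⟪A Λinv r, Λinv r⟫ ≥ 0` is dropped.  This is the whole
one-sidedness of the card; everything else is bookkeeping of the cross term. -/
theorem signed_corrector_ledger {E : Type*} [NormedAddCommGroup E] [InnerProductSpace ℝ E]
    (A Λinv : E →L[ℝ] E) (hApos : ∀ x, 0 ≤ ⟪A x, x⟫) (hAsymm : ∀ x y, ⟪A x, y⟫ = ⟪x, A y⟫) (f r : E) :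
    ⟪A (Λinv f), Λinv f⟫ - 2 * ⟪A (Λinv f), Λinv r⟫ ≤ ⟪A (Λinv (f - r)), Λinv (f - r)⟫ := by
  have hx : Λinv (f - r) = Λinv f - Λinv r := map_sub Λinv f r
  rw [hx, map_sub]
  simp only [inner_sub_left, inner_sub_right]
  have h1 : ⟪A (Λinv r), Λinv f⟫ = ⟪A (Λinv f), Λinv r⟫ := by
    rw [hAsymm, real_inner_comm]
  have h2 := hApos (Λinv r)
  linarith

/-- **Signed corrector ledger (identity form).**  The exact three-term split behind the inequality:
quasi-static form, cross term, dynamic defect. -/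
theorem corrector_ledger_identity {E : Type*} [NormedAddCommGroup E] [InnerProductSpace ℝ E]
    (A Λinv : E →L[ℝ] E) (hAsymm : ∀ x y, ⟪A x, y⟫ = ⟪x, A y⟫) (f r : E) :
    ⟪A (Λinv (f - r)), Λinv (f - r)⟫ =
      ⟪A (Λinv f), Λinv f⟫ - 2 * ⟪A (Λinv f), Λinv r⟫ + ⟪A (Λinv r), Λinv r⟫ := by
  have hx : Λinv (f - r) = Λinv f - Λinv r := map_sub Λinv f r
  rw [hx, map_sub]
  simp only [inner_sub_left, inner_sub_right]
  have h1 : ⟪A (Λinv r), Λinv f⟫ = ⟪A (Λinv f), Λinv r⟫ := by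
    rw [hAsymm, real_inner_comm]
  linarith

/-! ## §2 The one-sided chain -/

/-- **The LOWER renormalised tensor chain of `E`**: `LagrangianStep.Chain E` with the (unconsumed) upper drop ratio deleted. -/
def ChainLower {k : ℕ} (E : LatticeShear.LagrangianLatticeCarrier k) : Prop :=
  ∃ alo > (0:ℝ), ∃ ahi : ℝ, ∃ C > (0:ℝ), ∃ σ > (0:ℝ), ∀ R : ℝ≥0, ∃ mstar : ℕ, ∀ j, mstar ≤ j →
    ∃ 𝔸 : ℕ → Torus.Visc4 (Fin 3), 𝔸 j = Torus.isoVisc (E.kbar j) ∧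
      (∀ m, mstar ≤ m → m ≤ j → Torus.NearIso (𝔸 m) (E.kbar m * alo) (E.kbar m * ahi)) ∧
      ∀ m, mstar ≤ m → m < j → ∀ w₀ : VF, IsDatum w₀ → InClass R w₀ →
        (∃ v, TSol E m (𝔸 m) w₀ v) ∧
        ∀ u v : ℝ → VF, TSol E (m + 1) (𝔸 (m + 1)) w₀ u → TSol E m (𝔸 m) w₀ v →
          ∀ᵐ t ∂(volume.restrict (Ioo (1/2 : ℝ) 1)),
            0 ≤ drop w₀ v t ∧
            (1 - C * ((E.N m : ℝ) / E.N (m + 1)) ^ σ) * drop w₀ v t ≤ drop w₀ u t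

/-- Nothing is lost: the registered two-sided chain gives the lower chain. -/
theorem chainLower_of_chain {k : ℕ} (E : LatticeShear.LagrangianLatticeCarrier k) (h : Chain E) : ChainLower E := by
  obtain ⟨alo, halo, ahi, C, hC, σ, hσ, hR⟩ := h
  refine ⟨alo, halo, ahi, C, hC, σ, hσ, fun R => ?_⟩
  obtain ⟨mstar, hm⟩ := hR R
  refine ⟨mstar, fun j hj => ?_⟩
  obtain ⟨𝔸, h𝔸j, hNI, hstep⟩ := hm j hj
  refine ⟨𝔸, h𝔸j, hNI, fun m hm1 hm2 w₀ hD hCl => ?_⟩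
  obtain ⟨hex, hpair⟩ := hstep m hm1 hm2 w₀ hD hCl
  refine ⟨hex, fun u v hu hv => ?_⟩
  exact (hpair u v hu hv).mono fun t ht => ⟨ht.1, ht.2.1⟩

/-! ## §3 Telescoping from the lower chain (the landed proof, one conjunct fewer in the hypothesis) -/

/-- **Lower chain ⇒ cascade, abstractly.**  `LagrangianRenormalisationStep.cascade_of_chain_abstract` VERBATIM except that the
hypothesis no longer carries the upper ratio `dr w₀ u t ≤ (1 + C ρ^σ) dr w₀ v t` — the landed proof never used it. -/
theorem cascade_of_chainLower_abstract {V A : Type*}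
    (Sol : ℕ → A → V → (ℝ → V) → Prop) (NI : A → ℝ → ℝ → Prop) (iso : ℝ → A)
    (Dat : V → Prop) (Cls : ℝ≥0 → V → Prop) (kbar : ℕ → ℝ) (N : ℕ → ℕ) (dr : V → (ℝ → V) → ℝ → ℝ)
    (L : Filter ℝ)
    (hN : ∀ m, 0 < N m) (h2 : ∀ m, 2 * N m ≤ N (m + 1)) (hsq : ∀ m, N m ^ 2 ≤ N (m + 1))
    (hCh : ∃ alo > (0:ℝ), ∃ ahi : ℝ, ∃ C > (0:ℝ), ∃ σ > (0:ℝ), ∀ R : ℝ≥0, ∃ mstar : ℕ, ∀ j, mstar ≤ j →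
      ∃ 𝔸 : ℕ → A, 𝔸 j = iso (kbar j) ∧
        (∀ m, mstar ≤ m → m ≤ j → NI (𝔸 m) (kbar m * alo) (kbar m * ahi)) ∧
        ∀ m, mstar ≤ m → m < j → ∀ w₀ : V, Dat w₀ → Cls R w₀ →
          (∃ v, Sol m (𝔸 m) w₀ v) ∧
          ∀ u v : ℝ → V, Sol (m + 1) (𝔸 (m + 1)) w₀ u → Sol m (𝔸 m) w₀ v →
            ∀ᶠ t in L,
              0 ≤ dr w₀ v t ∧
              (1 - C * ((N m : ℝ) / N (m + 1)) ^ σ) * dr w₀ v t ≤ dr w₀ u t) :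
    ∃ a > (0:ℝ), ∀ R : ℝ≥0, ∃ mstar : ℕ, ∃ θ > (0:ℝ), ∃ j₁ : ℕ, ∀ j ≥ j₁,
      ∃ 𝔸s : A, ∃ hi : ℝ, NI 𝔸s (kbar mstar * a) hi ∧
        ∀ (w₀ : V) (u : ℝ → V), Dat w₀ → Cls R w₀ → Sol j (iso (kbar j)) w₀ u →
          ∃ v, Sol mstar 𝔸s w₀ v ∧ ∀ᶠ t in L, θ * dr w₀ v t ≤ dr w₀ u t := by
  obtain ⟨alo, halo, ahi, C, hC, σ, hσ, hR⟩ := hCh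
  refine ⟨alo, halo, fun R => ?_⟩
  obtain ⟨mstar, hm⟩ := hR R
  -- the one-level error `x m = C ρ_m^σ` is dominated by the geometric sequence `C r^m`, `r = (1/2)^σ < 1`
  set x : ℕ → ℝ := fun m => C * ((N m : ℝ) / N (m + 1)) ^ σ with hx_def
  set r : ℝ := (1 / 2 : ℝ) ^ σ with hr_def
  have hr0 : 0 < r := Real.rpow_pos_of_pos (by norm_num) σ
  have hr1 : r < 1 := Real.rpow_lt_one (by norm_num) (by norm_num) hσ
  have hρ0 : ∀ m, 0 ≤ (N m : ℝ) / N (m + 1) := fun m => by positivity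
  have hx0 : ∀ m, 0 ≤ x m := fun m => by
    simp only [hx_def]
    exact mul_nonneg hC.le (Real.rpow_nonneg (hρ0 m) σ)
  have hxr : ∀ m, x m ≤ C * r ^ m := fun m => by
    simp only [hx_def, hr_def]
    refine mul_le_mul_of_nonneg_left ?_ hC.le
    calc ((N m : ℝ) / N (m + 1)) ^ σ ≤ ((1 / 2 : ℝ) ^ m) ^ σ :=
          Real.rpow_le_rpow (hρ0 m) (ratio_le_half_pow hN h2 hsq m) hσ.le
      _ = ((1 / 2 : ℝ) ^ σ) ^ m := by
          rw [← Real.rpow_natCast, ← Real.rpow_mul (by norm_num), mul_comm, Real.rpow_mul (by norm_num),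
            Real.rpow_natCast]
  -- raise the base level until the tail of the errors is at most `1/2`
  obtain ⟨M₀, hM₀⟩ : ∃ M₀ : ℕ, C * r ^ M₀ ≤ (1 - r) / 2 := by
    have ht : Tendsto (fun n : ℕ => C * r ^ n) atTop (nhds (C * 0)) :=
      (tendsto_pow_atTop_nhds_zero_of_lt_one hr0.le hr1).const_mul C
    rw [mul_zero] at ht
    have hpos : (0 : ℝ) < (1 - r) / 2 := by linarith
    exact (ht.eventually (ge_mem_nhds hpos)).exists
  set M : ℕ := max mstar M₀ with hM_def
  have hMm : mstar ≤ M := le_max_left _ _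
  have hMM₀ : M₀ ≤ M := le_max_right _ _
  -- every error from level `M` on is at most `1/2`, and their partial sums stay below `1/2`
  have hx_half : ∀ m, M ≤ m → x m ≤ 1 / 2 := fun m hMle => by
    have h1 : r ^ m ≤ r ^ M₀ := pow_le_pow_of_le_one hr0.le hr1.le (le_trans hMM₀ hMle)
    have := hxr m
    nlinarith [hC]
  have hsum_half : ∀ n, ∑ i ∈ Finset.range n, x (M + i) ≤ 1 / 2 := fun n => by
    have hgeom : ∑ i ∈ Finset.range n, r ^ i ≤ (1 - r)⁻¹ := by
      have hs : Summable (fun i : ℕ => r ^ i) := summable_geometric_of_lt_one hr0.le hr1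
      calc ∑ i ∈ Finset.range n, r ^ i ≤ ∑' i : ℕ, r ^ i :=
            hs.sum_le_tsum (Finset.range n) (fun i _ => pow_nonneg hr0.le i)
        _ = (1 - r)⁻¹ := tsum_geometric_of_lt_one hr0.le hr1
    calc ∑ i ∈ Finset.range n, x (M + i) ≤ ∑ i ∈ Finset.range n, C * r ^ M * r ^ i := by
          refine Finset.sum_le_sum fun i _ => ?_
          calc x (M + i) ≤ C * r ^ (M + i) := hxr (M + i)
            _ = C * r ^ M * r ^ i := by rw [pow_add, mul_assoc]
      _ = C * r ^ M * ∑ i ∈ Finset.range n, r ^ i := by rw [Finset.mul_sum]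
      _ ≤ C * r ^ M * (1 - r)⁻¹ := mul_le_mul_of_nonneg_left hgeom (by positivity)
      _ ≤ C * r ^ M₀ * (1 - r)⁻¹ := by
          have h1 : r ^ M ≤ r ^ M₀ := pow_le_pow_of_le_one hr0.le hr1.le hMM₀
          have h2' : 0 < (1 - r)⁻¹ := inv_pos.mpr (by linarith)
          exact mul_le_mul_of_nonneg_right (mul_le_mul_of_nonneg_left h1 hC.le) h2'.le
      _ ≤ (1 - r) / 2 * (1 - r)⁻¹ := mul_le_mul_of_nonneg_right hM₀ (inv_pos.mpr (by linarith)).le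
      _ = 1 / 2 := by
          have hne : (1 - r) ≠ 0 := ne_of_gt (by linarith)
          calc (1 - r) / 2 * (1 - r)⁻¹ = ((1 - r) * (1 - r)⁻¹) / 2 := by ring
            _ = 1 / 2 := by rw [mul_inv_cancel₀ hne]
  refine ⟨M, 1 / 2, by norm_num, M + 1, fun j hj => ?_⟩
  obtain ⟨𝔸, h𝔸j, hNI, hstep⟩ := hm j (le_trans hMm (by omega))
  refine ⟨𝔸 M, kbar M * ahi, hNI M hMm (by omega), fun w₀ u hD hCl hu => ?_⟩
  -- descending induction: from a solution `n+1` levels above `m` to some level-`m` solution, compounding the lower ratios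
  have key : ∀ n m, M ≤ m → m + (n + 1) ≤ j → ∀ u' : ℝ → V, Sol (m + (n + 1)) (𝔸 (m + (n + 1))) w₀ u' →
      ∃ v, Sol m (𝔸 m) w₀ v ∧ ∀ᶠ t in L,
        0 ≤ dr w₀ v t ∧ (1 - ∑ i ∈ Finset.range (n + 1), x (m + i)) * dr w₀ v t ≤ dr w₀ u' t := by
    intro n
    induction n with
    | zero =>
      intro m hMle hmj u' hu'
      obtain ⟨⟨v, hv⟩, hpair⟩ := hstep m (le_trans hMm hMle) (by omega) w₀ hD hCl
      refine ⟨v, hv, ?_⟩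
      have h := hpair u' v (by simpa using hu') hv
      refine h.mono fun t ht => ⟨ht.1, ?_⟩
      simpa [hx_def] using ht.2
    | succ n ih =>
      intro m hMle hmj u' hu'
      -- one chain step at level `m + (n+1)`
      have e : m + (n + 1 + 1) = m + (n + 1) + 1 := by omega
      rw [e] at hu'
      obtain ⟨⟨v', hv'⟩, hpair⟩ := hstep (m + (n + 1)) (le_trans (le_trans hMm hMle) (by omega)) (by omega) w₀ hD hCl
      have hone := hpair u' v' hu' hv'
      -- the induction hypothesis from `v'`
      obtain ⟨v, hv, hih⟩ := ih m hMle (by omega) v' hv'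
      refine ⟨v, hv, (hone.and hih).mono fun t ht => ⟨ht.2.1, ?_⟩⟩
      obtain ⟨⟨_, hlow⟩, hvnn, hsumle⟩ := ht
      have hxle : x (m + (n + 1)) ≤ 1 / 2 := hx_half _ (by omega)
      have hxnn : 0 ≤ x (m + (n + 1)) := hx0 _
      have hfac : 0 ≤ 1 - x (m + (n + 1)) := by linarith
      have hSnn : 0 ≤ ∑ i ∈ Finset.range (n + 1), x (m + i) := Finset.sum_nonneg fun i _ => hx0 _
      have hlow' : (1 - x (m + (n + 1))) * dr w₀ v' t ≤ dr w₀ u' t := by simpa [hx_def] using hlow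
      have hmid : (1 - x (m + (n + 1))) * ((1 - ∑ i ∈ Finset.range (n + 1), x (m + i)) * dr w₀ v t) ≤
          (1 - x (m + (n + 1))) * dr w₀ v' t := mul_le_mul_of_nonneg_left hsumle hfac
      rw [Finset.sum_range_succ]
      have hcross : 0 ≤ x (m + (n + 1)) * (∑ i ∈ Finset.range (n + 1), x (m + i)) * dr w₀ v t :=
        mul_nonneg (mul_nonneg hxnn hSnn) hvnn
      nlinarith [hmid, hlow', hcross]
  -- apply it between the top level `j = M + (n+1)` and the base level `M`
  obtain ⟨n, rfl⟩ : ∃ n, j = M + (n + 1) := ⟨j - M - 1, by omega⟩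
  rw [← h𝔸j] at hu
  obtain ⟨v, hv, hfin⟩ := key n M le_rfl le_rfl u hu
  refine ⟨v, hv, hfin.mono fun t ht => ?_⟩
  obtain ⟨hvnn, hsumle⟩ := ht
  have hP : 1 / 2 ≤ 1 - ∑ i ∈ Finset.range (n + 1), x (M + i) := by
    have hS := hsum_half (n + 1)
    linarith
  calc 1 / 2 * dr w₀ v t ≤ (1 - ∑ i ∈ Finset.range (n + 1), x (M + i)) * dr w₀ v t :=
        mul_le_mul_of_nonneg_right hP hvnn
    _ ≤ dr w₀ u t := hsumle

/-- **The registered `stub_cascadeT` from the LOWER chain** (proposed v18 form `ChainLower E → Cascade E`). -/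
theorem cascade_of_chainLower {k : ℕ} (E : LatticeShear.LagrangianLatticeCarrier k) (hP : E.LPermissible)
    (hsq : ∀ m, E.N m ^ 2 ≤ E.N (m + 1)) (hCh : ChainLower E) : Cascade E :=
  cascade_of_chainLower_abstract
    (fun m 𝔸 w₀ u => TSol E m 𝔸 w₀ u) Torus.NearIso Torus.isoVisc IsDatum InClass
    E.kbar E.N drop (ae (volume.restrict (Ioo (1/2 : ℝ) 1)))
    E.N_pos hP.permissible.2.2.1 hsq hCh

/-- For the record: the registered two-sided `Chain E` also gives the cascade through the lower path. -/
theorem cascade_of_chain' {k : ℕ} (E : LatticeShear.LagrangianLatticeCarrier k) (hP : E.LPermissible)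
    (hsq : ∀ m, E.N m ^ 2 ≤ E.N (m + 1)) (hCh : Chain E) : Cascade E :=
  cascade_of_chainLower E hP hsq (chainLower_of_chain E hCh)

/-! ## §4 The lower chain from a ONE-SIDED one-level step (proposed v18 `stub_oneLevelL`) -/

/-- **`ChainLower E` from the pieces** — `LagrangianStep.chain_of_pieces` VERBATIM for the one-sided one-level step: `hone` is the
proposed v18 statement of `stub_oneLevelL` (every binder of v17 kept; conclusion = existence ∧ LOWER a.e. drop ratio only). -/
theorem chainLower_of_pieces
    (hba : ∀ k (E : LatticeShear.LagrangianLatticeCarrier k), E.LPermissible → E.Regular →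
    ∀ (m : ℕ) (𝔸 : Torus.Visc4 (Fin 3)) (lo hi : ℝ), 0 < lo → Torus.NearIso 𝔸 lo hi →
      ∀ (w₀ : VF) (u : ℝ → VF), IsDatum w₀ → TSol E m 𝔸 w₀ u →
        ∀ᵐ t ∂(volume.restrict (Ioo (1/2 : ℝ) 1)),
          (1 - Real.exp (-(4 * Real.pi ^ 2 * lo))) * Torus.vectorL2Sq w₀ ≤ drop w₀ u t)
    (hone : ∀ k (W : Literature.Analysis.FluidPDE.LatticeShear.LatticeWord k) (M : ℝ) (hM : 0 < M) (c : ℝ), 0 < c →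
    ∀ (Φ : Torus.Visc4 (Fin 3) → Torus.Visc4 (Fin 3)) (lo hi Λ β σ C ν₀ K Cf νf Kf : ℝ),
      0 < lo → lo ≤ 1 → 1 ≤ hi → 1 < Λ → 0 ≤ β → WindowClause Φ lo hi Λ β →
      0 < σ → 0 ≤ C → 0 < ν₀ → 0 < K → SlowVectorClause W M hM c Φ lo hi Λ β σ C ν₀ K →
      0 ≤ Cf → 0 < νf → 0 < Kf → CellEnergyClauses W M hM c lo hi Λ β Cf νf Kf →
      ∃ ν₁ > (0:ℝ), ∃ K₁ > (0:ℝ), ∃ Λ₀ : ℕ, ∃ θ₀ > (0:ℝ), ∃ C₁ > (0:ℝ), ∃ σ₁ > (0:ℝ),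
        ∀ E : Literature.Analysis.FluidPDE.LatticeShear.LagrangianLatticeCarrier k, E.design = W.stretch M hM → E.gain = c → E.nu0 = ν₁ → E.K = K₁ → E.LPermissible → E.Regular → (∀ m, Λ₀ * E.N m ≤ E.N (m + 1)) → (∀ m, E.N m ^ 2 ≤ E.N (m + 1)) → (∀ m, E.cellVisc (m + 1) * ((E.N (m + 1) : ℝ) / E.N m) ^ (1 / 4 : ℝ) ≤ 1) → (∀ m, E.K * ((E.N (m + 1) : ℝ) / E.N m) ^ (1 / 4 : ℝ) ≤ ((E.N (m + 1) : ℝ) / E.N m) * E.cellVisc (m + 1)) → (∀ m, E.θ (m + 1) * ((E.N (m + 1) : ℝ) / E.N m) ^ (1 / 16 : ℝ) ≤ θ₀) → (∀ m, ((E.N (m + 1) : ℝ) / E.N m) ^ (1 / 16 : ℝ) * E.physPeriod (m + 1) ≤ E.refresh (m + 1)) →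
        ∀ R : ℝ≥0, ∃ mstar : ℕ, ∀ m, mstar ≤ m →
          ∀ S : Torus.Visc4 (Fin 3), Torus.OddSmall S β → Torus.NearIso S lo hi →
          ∀ (w₀ : VF), IsDatum w₀ → InClass R w₀ →
          (∃ v, TSol E m (E.kbar m • renormStep Φ (E.gain / E.cellVisc (m + 1) ^ 2) S) w₀ v) ∧
          ∀ u v : ℝ → VF, TSol E (m + 1) (E.kbar (m + 1) • S) w₀ u →
            TSol E m (E.kbar m • renormStep Φ (E.gain / E.cellVisc (m + 1) ^ 2) S) w₀ v →
            ∀ᵐ t ∂(volume.restrict (Ioo (1/2 : ℝ) 1)),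
              (1 - C₁ * ((E.N m : ℝ) / E.N (m + 1)) ^ σ₁) * drop w₀ v t ≤ drop w₀ u t) :
    ∀ k (W : Literature.Analysis.FluidPDE.LatticeShear.LatticeWord k) (M : ℝ) (hM : 0 < M) (c : ℝ), 0 < c →
    ∀ (Φ : Torus.Visc4 (Fin 3) → Torus.Visc4 (Fin 3)) (lo hi Λ β σ C ν₀ K Cf νf Kf : ℝ),
      0 < lo → lo ≤ 1 → 1 ≤ hi → 1 < Λ → 0 ≤ β → WindowClause Φ lo hi Λ β →
      0 < σ → 0 ≤ C → 0 < ν₀ → 0 < K → SlowVectorClause W M hM c Φ lo hi Λ β σ C ν₀ K →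
      0 ≤ Cf → 0 < νf → 0 < Kf → CellEnergyClauses W M hM c lo hi Λ β Cf νf Kf →
      ∃ ν₁ > (0:ℝ), ∃ K₁ > (0:ℝ), ∃ Λ₀ : ℕ, ∃ θ₀ > (0:ℝ),
        ∀ E : Literature.Analysis.FluidPDE.LatticeShear.LagrangianLatticeCarrier k, E.design = W.stretch M hM → E.gain = c → E.nu0 = ν₁ → E.K = K₁ → E.LPermissible → E.Regular → (∀ m, Λ₀ * E.N m ≤ E.N (m + 1)) → (∀ m, E.N m ^ 2 ≤ E.N (m + 1)) → (∀ m, E.cellVisc (m + 1) * ((E.N (m + 1) : ℝ) / E.N m) ^ (1 / 4 : ℝ) ≤ 1) → (∀ m, E.K * ((E.N (m + 1) : ℝ) / E.N m) ^ (1 / 4 : ℝ) ≤ ((E.N (m + 1) : ℝ) / E.N m) * E.cellVisc (m + 1)) → (∀ m, E.θ (m + 1) * ((E.N (m + 1) : ℝ) / E.N m) ^ (1 / 16 : ℝ) ≤ θ₀) → (∀ m, ((E.N (m + 1) : ℝ) / E.N m) ^ (1 / 16 : ℝ) * E.physPeriod (m + 1) ≤ E.refresh (m + 1)) → ChainLower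 E := by
  intro k W M hM c hc Φ lo hi Λ β σ C ν₀ K Cf νf Kf hlo hlo1 hhi1 hΛ hβ hwin hσ hC hν₀ hK hV hCf hνf hKf hEcl
  obtain ⟨ν₁, hν₁, K₁, hK₁, Λ₀, θ₀, hθ₀, C₁, hC₁, σ₁, hσ₁, hlev⟩ :=
    hone k W M hM c hc Φ lo hi Λ β σ C ν₀ K Cf νf Kf hlo hlo1 hhi1 hΛ hβ hwin hσ hC hν₀ hK hV hCf hνf hKf hEcl
  refine ⟨ν₁, hν₁, K₁, hK₁, Λ₀, θ₀, hθ₀, ?_⟩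
  intro E hW hg hn hK' hP hR h1a h1b h2 h3 h4 h5
  have hlevE := hlev E hW hg hn hK' hP hR h1a h1b h2 h3 h4 h5
  have hgpos : ∀ i, 0 ≤ E.gain / E.cellVisc i ^ 2 := fun i => div_nonneg E.gain_pos.le (sq_nonneg _)
  have hwinS : ∀ j d, Torus.OddSmall (shapeSeq Φ (fun i => E.gain / E.cellVisc i ^ 2) j d) β ∧
      Torus.NearIso (shapeSeq Φ (fun i => E.gain / E.cellVisc i ^ 2) j d) lo hi :=
    fun j d => shapeSeq_window hlo1 hhi1 hΛ.le hβ hwin hgpos j d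
  have hwinT : ∀ j m, Torus.NearIso (chainTensor E Φ j m) (E.kbar m * lo) (E.kbar m * hi) :=
    fun j m => ((hwinS j (j - m)).2).smul (E.kbar_pos m).le
  refine ⟨lo, hlo, hi, C₁, hC₁, σ₁, hσ₁, ?_⟩
  intro R
  obtain ⟨mstar, hm⟩ := hlevE R
  refine ⟨mstar, fun j hj => ⟨chainTensor E Φ j, chainTensor_top E Φ j, fun m _ _ => hwinT j m, ?_⟩⟩
  intro m hm1 hm2 w₀ hdat hcl
  have hstep := hm m hm1 (shapeSeq Φ (fun i => E.gain / E.cellVisc i ^ 2) j (j - (m + 1)))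
    (hwinS j (j - (m + 1))).1 (hwinS j (j - (m + 1))).2 w₀ hdat hcl
  refine ⟨?_, ?_⟩
  · rw [chainTensor_succ E Φ hm2]
    exact hstep.1
  intro u v hu hv
  have hv' := hv
  rw [chainTensor_succ E Φ hm2] at hv'
  have hu' : TSol E (m + 1) (E.kbar (m + 1) • shapeSeq Φ (fun i => E.gain / E.cellVisc i ^ 2) j (j - (m + 1))) w₀ u := hu
  have hcmp := hstep.2 u v hu' hv'
  have hbase := hba k E hP hR m (chainTensor E Φ j m) (E.kbar m * lo) (E.kbar m * hi)
    (mul_pos (E.kbar_pos m) hlo) (hwinT j m) w₀ v hdat hv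
  have hcb : 0 ≤ 1 - Real.exp (-(4 * Real.pi ^ 2 * (E.kbar m * lo))) := by
    have hexp : Real.exp (-(4 * Real.pi ^ 2 * (E.kbar m * lo))) < 1 := by
      rw [Real.exp_lt_one_iff]
      have : 0 < 4 * Real.pi ^ 2 * (E.kbar m * lo) := by
        have := E.kbar_pos m
        positivity
      linarith
    linarith
  have hL2 : 0 ≤ Torus.vectorL2Sq w₀ := by
    show 0 ≤ ∫ x, ‖w₀ x‖ ^ 2
    exact integral_nonneg fun x => by positivity
  filter_upwards [hcmp, hbase] with t h1 h2
  exact ⟨le_trans (mul_nonneg hcb hL2) h2, h1⟩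

/-- **`ChainLower E` from the one-sided one-level step alone** (base estimate = the landed `LagrangianStep.stub_baseT`, p612457). -/
theorem chainLower_of_oneLevelLower
    (hone : ∀ k (W : Literature.Analysis.FluidPDE.LatticeShear.LatticeWord k) (M : ℝ) (hM : 0 < M) (c : ℝ), 0 < c →
    ∀ (Φ : Torus.Visc4 (Fin 3) → Torus.Visc4 (Fin 3)) (lo hi Λ β σ C ν₀ K Cf νf Kf : ℝ),
      0 < lo → lo ≤ 1 → 1 ≤ hi → 1 < Λ → 0 ≤ β → WindowClause Φ lo hi Λ β →
      0 < σ → 0 ≤ C → 0 < ν₀ → 0 < K → SlowVectorClause W M hM c Φ lo hi Λ β σ C ν₀ K →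
      0 ≤ Cf → 0 < νf → 0 < Kf → CellEnergyClauses W M hM c lo hi Λ β Cf νf Kf →
      ∃ ν₁ > (0:ℝ), ∃ K₁ > (0:ℝ), ∃ Λ₀ : ℕ, ∃ θ₀ > (0:ℝ), ∃ C₁ > (0:ℝ), ∃ σ₁ > (0:ℝ),
        ∀ E : Literature.Analysis.FluidPDE.LatticeShear.LagrangianLatticeCarrier k, E.design = W.stretch M hM → E.gain = c → E.nu0 = ν₁ → E.K = K₁ → E.LPermissible → E.Regular → (∀ m, Λ₀ * E.N m ≤ E.N (m + 1)) → (∀ m, E.N m ^ 2 ≤ E.N (m + 1)) → (∀ m, E.cellVisc (m + 1) * ((E.N (m + 1) : ℝ) / E.N m) ^ (1 / 4 : ℝ) ≤ 1) → (∀ m, E.K * ((E.N (m + 1) : ℝ) / E.N m) ^ (1 / 4 : ℝ) ≤ ((E.N (m + 1) : ℝ) / E.N m) * E.cellVisc (m + 1)) → (∀ m, E.θ (m + 1) * ((E.N (m + 1) : ℝ) / E.N m) ^ (1 / 16 : ℝ) ≤ θ₀) → (∀ m, ((E.N (m + 1) : ℝ) / E.N m) ^ (1 / 16 : ℝ) *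 E.physPeriod (m + 1) ≤ E.refresh (m + 1)) →
        ∀ R : ℝ≥0, ∃ mstar : ℕ, ∀ m, mstar ≤ m →
          ∀ S : Torus.Visc4 (Fin 3), Torus.OddSmall S β → Torus.NearIso S lo hi →
          ∀ (w₀ : VF), IsDatum w₀ → InClass R w₀ →
          (∃ v, TSol E m (E.kbar m • renormStep Φ (E.gain / E.cellVisc (m + 1) ^ 2) S) w₀ v) ∧
          ∀ u v : ℝ → VF, TSol E (m + 1) (E.kbar (m + 1) • S) w₀ u →
            TSol E m (E.kbar m • renormStep Φ (E.gain / E.cellVisc (m + 1) ^ 2) S) w₀ v →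
            ∀ᵐ t ∂(volume.restrict (Ioo (1/2 : ℝ) 1)),
              (1 - C₁ * ((E.N m : ℝ) / E.N (m + 1)) ^ σ₁) * drop w₀ v t ≤ drop w₀ u t) :
    ∀ k (W : Literature.Analysis.FluidPDE.LatticeShear.LatticeWord k) (M : ℝ) (hM : 0 < M) (c : ℝ), 0 < c →
    ∀ (Φ : Torus.Visc4 (Fin 3) → Torus.Visc4 (Fin 3)) (lo hi Λ β σ C ν₀ K Cf νf Kf : ℝ),
      0 < lo → lo ≤ 1 → 1 ≤ hi → 1 < Λ → 0 ≤ β → WindowClause Φ lo hi Λ β →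
      0 < σ → 0 ≤ C → 0 < ν₀ → 0 < K → SlowVectorClause W M hM c Φ lo hi Λ β σ C ν₀ K →
      0 ≤ Cf → 0 < νf → 0 < Kf → CellEnergyClauses W M hM c lo hi Λ β Cf νf Kf →
      ∃ ν₁ > (0:ℝ), ∃ K₁ > (0:ℝ), ∃ Λ₀ : ℕ, ∃ θ₀ > (0:ℝ),
        ∀ E : Literature.Analysis.FluidPDE.LatticeShear.LagrangianLatticeCarrier k, E.design = W.stretch M hM → E.gain = c → E.nu0 = ν₁ → E.K = K₁ → E.LPermissible → E.Regular → (∀ m, Λ₀ * E.N m ≤ E.N (m + 1)) → (∀ m, E.N m ^ 2 ≤ E.N (m + 1)) → (∀ m, E.cellVisc (m + 1) * ((E.N (m + 1) : ℝ) / E.N m) ^ (1 / 4 : ℝ) ≤ 1) → (∀ m, E.K * ((E.N (m + 1) : ℝ) / E.N m) ^ (1 / 4 : ℝ) ≤ ((E.N (m + 1) : ℝ) / E.N m) * E.cellVisc (m + 1)) → (∀ m, E.θ (m + 1) * ((E.N (m + 1) : ℝ) / E.N m) ^ (1 / 16 : ℝ) ≤ θ₀) → (∀ m, ((E.N (m +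 1) : ℝ) / E.N m) ^ (1 / 16 : ℝ) * E.physPeriod (m + 1) ≤ E.refresh (m + 1)) → ChainLower E :=
  chainLower_of_pieces stub_baseT hone

end

end Summit.AnomalousDissipation.AnomalousDissipation.Cruxes.LagrangianRenormalisationStep.OneSidedChain
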